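import Summits.ABC.ABC.Theorems.ThetaPartII.Negative.StubHullRegimeAboveFalseOfDeepLopsidedDatum
import Literature.IUT.LogVolume.GenuineLogThetaPointDegrees
import Literature.IUT.LogVolume.PilotDataBaseChange
import HarnessLib

/-!
# Crux `ThetaPartII` (stmt-ABC-19678), (U) line: what the registered `stub_hullRegimeAbove` DEMANDS of every genuine
# Θ-volume datum — an explicit pair inequality at each support prime, in the vocabulary of `(P, l)` ([IUTchIV] Thm. 1.10 Step (v))

Record-only PROOF file (D-0012) of the abc-iut cell (campaign-S seat abc-iut-S4, gen 6); TAKES NO SIDE on [IUTchIII]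
Cor. 3.12, on [IUTchIV] Thm. 1.10, or on the (U)/(P) readings of "`−|log(Θ)|`". VERDICT RISK ¶7 asks what the UNION
line's volume stub costs. The registered `stub_hullRegimeAbove` (skeleton abc-iut-c312-8 `0bf3ba3d3910cd8b`; the `habove`
binder of abc-iut-S3's `ABC_of_cor312_of_hullRegimeAbove`) asserts print's hull estimate `T.HullEstimateOf (B P l)` at
every genuine datum `T` of every admissible `(P, l)` with `2 ≤ d_mod` above abc-iut-c312-d1's threshold that is NOT
slot-constant. This file states its NECESSARY CONDITION in closed form (`pair_le_slack_of_stub_hullRegimeAbove`): the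
stub implies, for every such `(P, l)` with `4·d_mod ≤ l + 5`, EVERY genuine datum `T` (slot-constant or not), every
support prime `p` and all places `v, w` of `F_mod` over `p`,
`Pr(v)·Pr(w)·(l(l+1)/12)·(μ(v) − μ(w)) ≤ B(P,l) − ((l+5)/4 − d_mod)·(log-diff(λ) + (1 − 1/l)·log 𝔣^{F_tpd}_{∤2l})`,
`μ(u) = P_q(u)·ln N(u)/n_u = log(q_u)/(2l)` the normalised local height of the `q`-pilot at `u`, `Pr(u) = n_u/d_mod`. At a
slot-constant datum the left side vanishes (`log(q_v) = log(q_w)`) and the right side is `≥ 0`; at a non-slot-constant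
datum this is the chain abc-iut-w6-d018 sharp window → this seat's `ForkGenuineWindowSharpCond` (`log 𝔡^K ≥ log-diff +
(1−1/l)·log-cond`, [IUTchIV] Step (ii) with the (P5) choice) → abc-iut-S8's pair bound, with `[F_mod:ℚ] = d_mod`
(abc-iut-L5-t3 `finrank_rat_fieldOfModuli_eq_dmod`) and `ℓ⋇ = (l−1)/2` substituted. READING (no side taken): the (U)
stub is not free bookkeeping — it is itself a uniform, explicit bound on the discrepancy of normalised local heights of
`q` between places of `F_mod` over one rational prime, i.e. a Diophantine statement about the `λ`-line of the same
currency (`log-diff + log-cond` against local heights) as the inequality the route wants to conclude; its contrapositive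
is the negative lemma `Negative/StubHullRegimeAboveFalseOfDeepLopsidedDatum` (p445919). Nothing here asserts the stub, its
negation, or anything disputed. [cite: Mochizuki2012, IUTchIV Thm. 1.10 Step (v) p. 27–29] [cite: DupuyHilado2025, §3.3,
§4.7, §4.12] [claim: Mochizuki2012, status: disputed] for every IUT quotation. PROOF-ONLY file.
-/

noncomputable section

-- `Summit.<Summit>.<Problem>` is the mandated summit-side namespace (CONVENTIONS §2); for the
-- single-conjunct summit `ABC` the two coincide, so the duplicate `ABC.ABC` is deliberate.
set_option linter.dupNamespace false

namespace Summit.ABC.ABC.Theorems.ThetaPartII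

open Literature.NumberTheory.DiophantineGeometry.GenEll Literature.IUT.LogVolume Literature.IUT.HodgeTheaters
open Summit.ABC.IUTFork NumberField IsDedekindDomain

/-- `ℓ⋇ = (l−1)/2` at a genuine Θ-volume datum, as a real number (the input's pilot data are those of `T.D`,
`T.isVolumeInputOf.X_eq`; `l = 2·ℓ⋇ + 1`, [IUTchI] Def. 3.1 (c)). [cite: Mochizuki2012, IUTchI Def. 3.1 (c) p. 61] -/
private theorem lstar_cast_eq {P : NFPoint} {l : ℕ} (T : Cor22.ThetaVolumeDatumAt P l) :
    (letI := T.instFieldF; letI := T.instNumberFieldF; letI := T.instFieldK; letI := T.instNumberFieldK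
     letI := T.instAlgebraK; letI := T.instIsElliptic; ((T.I.X.lstar : ℕ) : ℝ)) = ((l : ℝ) - 1) / 2 := by
  letI := T.instFieldF; letI := T.instNumberFieldF; letI := T.instAlgebraF; letI := T.instFieldK
  letI := T.instNumberFieldK; letI := T.instAlgebraK; letI := T.instFieldFbar; letI := T.instAlgebraFbar
  letI := T.instAlgebraKFbar; letI := T.instIsElliptic
  have hX : T.I.X.lstar = Thm311.Real.lstarOf T.D := by rw [T.isVolumeInputOf.X_eq]; rfl
  have hlR : (l : ℝ) = 2 * (Thm311.Real.lstarOf T.D : ℝ) + 1 := by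
    exact_mod_cast Thm311.Real.l_eq_two_mul_lstarOf_add_one T.D
  change ((T.I.X.lstar : ℕ) : ℝ) = ((l : ℝ) - 1) / 2
  rw [hX, hlR]; ring

/-- **The slack is nonnegative**: for `l ≥ 5`, `1 ≤ d_mod` and `4·d_mod ≤ l + 5`,
`0 ≤ B(P,l) − ((l+5)/4 − d_mod)·(log-diff(λ) + (1 − 1/l)·log 𝔣^{F_tpd}_{∤2l})` (`log-diff, log-cond ≥ 0`; the coefficient
`(l+1)/4·(1 + 12·d_mod/l)` of `B(P,l)` dominates `(l+5)/4 − d_mod`). Elementary. [cite: Mochizuki2012, IUTchIV Thm. 1.10 Step (viii) p. 29] -/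
theorem slack_nonneg (P : NFPoint) {l : ℕ} (hl : l.Prime) (hd1 : 1 ≤ Cor22.dmod P) (hdl : 4 * Cor22.dmod P ≤ l + 5) :
    0 ≤ ((l : ℝ) + 1) / 4 *
          ((1 + 12 * (Cor22.dmod P : ℝ) / l) * (P.logDiff + Cor22.logCondAvoid P {2, l})
            + 2 * Real.log l + 52
            + 20 / 3 * Real.log (((2 ^ 12 * 3 ^ 3 * 5 * Cor22.dmod P : ℕ) : ℝ) * (l : ℝ))
              * (Nat.primeCounting (2 ^ 12 * 3 ^ 3 * 5 * Cor22.dmod P * l) : ℝ))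
        - (((l : ℝ) + 5) / 4 - (Cor22.dmod P : ℝ)) *
            (P.logDiff + (1 - 1 / (l : ℝ)) * Cor22.logCondAvoid P {2, l}) := by
  have hl0 : (0 : ℝ) < l := by exact_mod_cast hl.pos
  have hl1 : (1 : ℝ) ≤ l := by exact_mod_cast hl.one_lt.le
  have hD := P.logDiff_nonneg
  have hC := Cor22.logCondAvoid_nonneg P {2, l}
  have hd1R : (1 : ℝ) ≤ Cor22.dmod P := by exact_mod_cast hd1
  have hdlR : 4 * (Cor22.dmod P : ℝ) ≤ (l : ℝ) + 5 := by exact_mod_cast hdl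
  have hlog : 0 ≤ Real.log l := Real.log_nonneg hl1
  have hlog2 : 0 ≤ Real.log (((2 ^ 12 * 3 ^ 3 * 5 * Cor22.dmod P : ℕ) : ℝ) * (l : ℝ)) := by
    refine Real.log_nonneg ?_
    have h1 : (1 : ℝ) ≤ ((2 ^ 12 * 3 ^ 3 * 5 * Cor22.dmod P : ℕ) : ℝ) := by
      have : 1 ≤ 2 ^ 12 * 3 ^ 3 * 5 * Cor22.dmod P := by
        have : 1 ≤ Cor22.dmod P := hd1
        omega
      exact_mod_cast this
    nlinarith
  have hπ : 0 ≤ (Nat.primeCounting (2 ^ 12 * 3 ^ 3 * 5 * Cor22.dmod P * l) : ℝ) := Nat.cast_nonneg _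
  have hR : 0 ≤ 2 * Real.log l + 52
      + 20 / 3 * Real.log (((2 ^ 12 * 3 ^ 3 * 5 * Cor22.dmod P : ℕ) : ℝ) * (l : ℝ))
        * (Nat.primeCounting (2 ^ 12 * 3 ^ 3 * 5 * Cor22.dmod P * l) : ℝ) := by
    have := mul_nonneg (mul_nonneg (by norm_num : (0 : ℝ) ≤ 20 / 3) hlog2) hπ
    linarith
  have h12 : 0 ≤ 12 * (Cor22.dmod P : ℝ) / l := by positivity
  have hA : ((l : ℝ) + 5) / 4 - (Cor22.dmod P : ℝ) ≤ ((l : ℝ) + 1) / 4 * (1 + 12 * (Cor22.dmod P : ℝ) / l) := by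
    nlinarith
  have hB : 0 ≤ ((l : ℝ) + 5) / 4 - (Cor22.dmod P : ℝ) := by linarith
  have h1l : 1 - 1 / (l : ℝ) ≤ 1 := by
    have : 0 ≤ 1 / (l : ℝ) := by positivity
    linarith
  have hB' : (((l : ℝ) + 5) / 4 - (Cor22.dmod P : ℝ)) * (1 - 1 / (l : ℝ)) ≤ ((l : ℝ) + 5) / 4 - (Cor22.dmod P : ℝ) :=
    mul_le_of_le_one_right hB h1l
  have hexp : ((l : ℝ) + 1) / 4 *
          ((1 + 12 * (Cor22.dmod P : ℝ) / l) * (P.logDiff + Cor22.logCondAvoid P {2, l})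
            + 2 * Real.log l + 52
            + 20 / 3 * Real.log (((2 ^ 12 * 3 ^ 3 * 5 * Cor22.dmod P : ℕ) : ℝ) * (l : ℝ))
              * (Nat.primeCounting (2 ^ 12 * 3 ^ 3 * 5 * Cor22.dmod P * l) : ℝ))
        - (((l : ℝ) + 5) / 4 - (Cor22.dmod P : ℝ)) *
            (P.logDiff + (1 - 1 / (l : ℝ)) * Cor22.logCondAvoid P {2, l}) =
      (((l : ℝ) + 1) / 4 * (1 + 12 * (Cor22.dmod P : ℝ) / l) - (((l : ℝ) + 5) / 4 - (Cor22.dmod P : ℝ))) * P.logDiff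
        + (((l : ℝ) + 1) / 4 * (1 + 12 * (Cor22.dmod P : ℝ) / l)
            - (((l : ℝ) + 5) / 4 - (Cor22.dmod P : ℝ)) * (1 - 1 / (l : ℝ))) * Cor22.logCondAvoid P {2, l}
        + ((l : ℝ) + 1) / 4 * (2 * Real.log l + 52
            + 20 / 3 * Real.log (((2 ^ 12 * 3 ^ 3 * 5 * Cor22.dmod P : ℕ) : ℝ) * (l : ℝ))
              * (Nat.primeCounting (2 ^ 12 * 3 ^ 3 * 5 * Cor22.dmod P * l) : ℝ)) := by
    ring
  rw [hexp]
  refine add_nonneg (add_nonneg (mul_nonneg (by linarith) hD) (mul_nonneg (by linarith) hC))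
    (mul_nonneg (by positivity) hR)

/-- **What `stub_hullRegimeAbove` demands of every genuine datum (explicit pair inequality).** Assume the statement
registered as `stub_hullRegimeAbove` (the `habove` binder of `ABC_of_cor312_of_hullRegimeAbove`). Then for every
admissible `(P, l)` in its regime (`λ ∈ U_P`, `l ≥ 5` prime, `AdmitsCore`, (P2), (P5), (P6), `2 ≤ d_mod`, above
abc-iut-c312-d1's threshold) with `4·d_mod ≤ l + 5`, EVERY genuine Θ-volume datum `T` at `(P, l)`, every support prime
`p` and all places `v, w` of `F_mod` over `p`:
`Pr(v)·Pr(w)·(l(l+1)/12)·(μ(v) − μ(w)) ≤ B(P,l) − ((l+5)/4 − d_mod)·(log-diff(λ) + (1 − 1/l)·log 𝔣^{F_tpd}_{∤2l})`,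
`μ(u) = P_q(u)·ln N(u)/n_u`. Slot-constant data: both `μ` agree (`log(q_v) = log(q_w)`, `P_q = 𝔮/(2l)`) and the slack is
`≥ 0` (`slack_nonneg`). Other data: the stub gives `T.HullEstimateOf (B P l)`; then abc-iut-w6-d018's sharp window in
`log 𝔡^K`-currency (`GenuineContent.slotResidue_add_mul_ndeg_le_of_hullEstimateOf`), this seat's Step (ii) lower bound
(`Cor22.ThetaVolumeDatumAt.ndeg_differentDivisor_ge`), abc-iut-S8's `PilotData.slotResidue_ge_pair_closed`, and
`[F_mod:ℚ] = d_mod`, `ℓ⋇ = (l−1)/2`. An implication from the registered stub; NOTHING is asserted about the stub.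
[cite: Mochizuki2012, IUTchIV Thm. 1.10 Step (v) p. 27–29] [cite: DupuyHilado2025, §3.3, §4.12]
[claim: Mochizuki2012, status: disputed] -/
theorem pair_le_slack_of_stub_hullRegimeAbove
    (habove : ∀ P : NFPoint, P ∈ UP → ∀ l : ℕ, l.Prime → 5 ≤ l →
        Cor22.AdmitsCore P → Cor22.CondP2 P l → Cor22.CondP5 P l → Cor22.CondP6 P l →
        2 ≤ Cor22.dmod P →
        40 * Real.log (((2 ^ 12 * 3 ^ 3 * 5 * Cor22.dmod P : ℕ) : ℝ) * l)
          * ((Nat.primeCounting (2 ^ 12 * 3 ^ 3 * 5 * Cor22.dmod P * l) : ℝ)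
            - (2 * (Cor22.dmod P : ℝ) * (P.logDiff + Cor22.logCondAvoid P {2, l}) + Real.log (2 * 3 * 5 * (l : ℝ)))
              / Real.log 2) < Cor22.logQAvoid P {2, l} →
        ∀ T : Cor22.ThetaVolumeDatumAt P l,
          (letI := T.instFieldF; letI := T.instNumberFieldF; letI := T.instAlgebraF; letI := T.instFieldK
           letI := T.instNumberFieldK; letI := T.instAlgebraK; letI := T.instFieldFbar; letI := T.instAlgebraFbar
           letI := T.instAlgebraKFbar; letI := T.instIsElliptic
           ¬ (∀ p ∈ T.I.supportPrimes, ∀ v w : placesOver (fieldOfModuli T.E) p,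
              (DHData.ofInput T.I).logQloc p v = (DHData.ofInput T.I).logQloc p w)) →
          T.HullEstimateOf
            (((l : ℝ) + 1) / 4 *
              ((1 + 12 * (Cor22.dmod P : ℝ) / l) * (P.logDiff + Cor22.logCondAvoid P {2, l})
                + 2 * Real.log l + 52
                + 20 / 3 * Real.log (((2 ^ 12 * 3 ^ 3 * 5 * Cor22.dmod P : ℕ) : ℝ) * (l : ℝ))
                  * (Nat.primeCounting (2 ^ 12 * 3 ^ 3 * 5 * Cor22.dmod P * l) : ℝ)))) :
    ∀ P : NFPoint, P ∈ UP → ∀ l : ℕ, l.Prime → 5 ≤ l →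
      Cor22.AdmitsCore P → Cor22.CondP2 P l → Cor22.CondP5 P l → Cor22.CondP6 P l → 2 ≤ Cor22.dmod P →
      40 * Real.log (((2 ^ 12 * 3 ^ 3 * 5 * Cor22.dmod P : ℕ) : ℝ) * l)
        * ((Nat.primeCounting (2 ^ 12 * 3 ^ 3 * 5 * Cor22.dmod P * l) : ℝ)
          - (2 * (Cor22.dmod P : ℝ) * (P.logDiff + Cor22.logCondAvoid P {2, l}) + Real.log (2 * 3 * 5 * (l : ℝ)))
            / Real.log 2) < Cor22.logQAvoid P {2, l} →
      4 * Cor22.dmod P ≤ l + 5 →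
      ∀ T : Cor22.ThetaVolumeDatumAt P l,
        (letI := T.instFieldF; letI := T.instNumberFieldF; letI := T.instAlgebraF; letI := T.instFieldK
         letI := T.instNumberFieldK; letI := T.instAlgebraK; letI := T.instFieldFbar; letI := T.instAlgebraFbar
         letI := T.instAlgebraKFbar; letI := T.instIsElliptic
         ∀ (p : ℕ) [Fact p.Prime], p ∈ T.I.supportPrimes → ∀ v w : placesOver (fieldOfModuli T.E) p,
           weight (fieldOfModuli T.E) v.1 * weight (fieldOfModuli T.E) w.1 * ((l : ℝ) * ((l : ℝ) + 1) / 12) *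
               (T.I.X.qPilot v.1 * logNorm (fieldOfModuli T.E) v.1 / (localDegree (fieldOfModuli T.E) v.1 : ℝ)
                 - T.I.X.qPilot w.1 * logNorm (fieldOfModuli T.E) w.1 /
                   (localDegree (fieldOfModuli T.E) w.1 : ℝ)) ≤
             ((l : ℝ) + 1) / 4 *
                 ((1 + 12 * (Cor22.dmod P : ℝ) / l) * (P.logDiff + Cor22.logCondAvoid P {2, l})
                   + 2 * Real.log l + 52
                   + 20 / 3 * Real.log (((2 ^ 12 * 3 ^ 3 * 5 * Cor22.dmod P : ℕ) : ℝ) * (l : ℝ))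
                     * (Nat.primeCounting (2 ^ 12 * 3 ^ 3 * 5 * Cor22.dmod P * l) : ℝ))
               - (((l : ℝ) + 5) / 4 - (Cor22.dmod P : ℝ)) *
                   (P.logDiff + (1 - 1 / (l : ℝ)) * Cor22.logCondAvoid P {2, l})) := by
  intro P hP l hl h5 hcore h2 h5' h6 hd2 hthr hdl T
  letI := T.instFieldF; letI := T.instNumberFieldF; letI := T.instAlgebraF; letI := T.instFieldK
  letI := T.instNumberFieldK; letI := T.instAlgebraK; letI := T.instFieldFbar; letI := T.instAlgebraFbar
  letI := T.instAlgebraKFbar; letI := T.instIsElliptic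
  intro p _ hpT v w
  have hslack := slack_nonneg P hl (le_trans (by norm_num) hd2) hdl
  -- the datum's invariants are functions of `(P, l)`
  have hfin : (Module.finrank ℚ (fieldOfModuli T.E) : ℝ) = (Cor22.dmod P : ℝ) := by
    exact_mod_cast T.finrank_rat_fieldOfModuli_eq_dmod
  have hls : ((T.I.X.lstar : ℕ) : ℝ) = ((l : ℝ) - 1) / 2 := lstar_cast_eq T
  have hdlR : (4 : ℝ) * (Cor22.dmod P : ℝ) ≤ (l : ℝ) + 5 := by exact_mod_cast hdl
  have e1 : ((T.I.X.lstar : ℝ) + 3) / 2 = ((l : ℝ) + 5) / 4 := by rw [hls]; ring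
  have e2 : (((T.I.X.lstar : ℝ) + 1) * (2 * T.I.X.lstar + 1)) / 6 = (l : ℝ) * ((l : ℝ) + 1) / 12 := by
    rw [hls]; ring
  by_cases hsc : ∀ p ∈ T.I.supportPrimes, ∀ v w : placesOver (fieldOfModuli T.E) p,
      (DHData.ofInput T.I).logQloc p v = (DHData.ofInput T.I).logQloc p w
  · -- slot-constant datum: `μ(v) = μ(w)` since `P_q(u)·ln N(u)/n_u = log(q_u)/(2l)`
    have hq : ∀ u : placesOver (fieldOfModuli T.E) p,
        T.I.X.qPilot u.1 * logNorm (fieldOfModuli T.E) u.1 / (localDegree (fieldOfModuli T.E) u.1 : ℝ) =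
          (DHData.ofInput T.I).logQloc p u / (2 * (T.I.X.l : ℝ)) := by
      intro u
      simp only [DHData.logQloc, DHData.ofInput_X]
      rw [PilotData.qPilot_apply, PilotData.qDivisor_apply]
      split_ifs <;> ring
    rw [hq v, hq w, hsc p hpT v w, sub_self, mul_zero]
    exact hslack
  · -- not slot-constant: the stub gives the hull estimate with `B(P,l)`; sharp lower window + Step (ii) + pair bound
    have hEst := habove P hP l hl h5 hcore h2 h5' h6 hd2 hthr T hsc
    haveI := T.isGalois_fieldOfModuli_K
    have h1 := GenuineContent.slotResidue_add_mul_ndeg_le_of_hullEstimateOf T.I hEst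
    have h2' := T.ndeg_differentDivisor_ge hl.pos
    have hc : 0 ≤ ((T.I.X.lstar : ℝ) + 3) / 2 - Module.finrank ℚ (fieldOfModuli T.E) := by
      rw [e1, hfin]; linarith
    have h3 := mul_le_mul_of_nonneg_left h2' hc
    have h4 := T.I.X.slotResidue_ge_pair_closed T.I.supportPrimes hpT v w
    change T.I.X.slotResidue T.I.supportPrimes +
        (((T.I.X.lstar : ℝ) + 3) / 2 - Module.finrank ℚ (fieldOfModuli T.E)) * ndeg T.K (differentDivisor T.K) ≤ _ at h1
    change P.logDiff + (1 - 1 / (l : ℝ)) * Cor22.logCondAvoid P {2, l} ≤ ndeg T.K (differentDivisor T.K) at h2'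
    rw [e1, hfin] at h1 h3
    rw [e2] at h4
    linarith

/-- **`stub_hullRegimeAbove` is false modulo ONE lopsided admissible datum — no slot-constancy clause.** If some
admissible `(P, l)` in the regime of the registered stub (`λ ∈ U_P`, `l ≥ 5` prime, `AdmitsCore`, (P2), (P5), (P6),
`2 ≤ d_mod`, above abc-iut-c312-d1's threshold) with `4·d_mod ≤ l + 5` carries a genuine Θ-volume datum `T` and a support
prime `p` with places `v, w` of `F_mod` over `p` at which the explicit pair inequality FAILS,
`B(P,l) − ((l+5)/4 − d_mod)·(log-diff(λ) + (1 − 1/l)·log 𝔣^{F_tpd}_{∤2l}) < Pr(v)·Pr(w)·(l(l+1)/12)·(μ(v) − μ(w))`, then the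
statement registered as `stub_hullRegimeAbove` is false — the contrapositive of `pair_le_slack_of_stub_hullRegimeAbove`
(such a datum is automatically not slot-constant: at a slot-constant datum the right side vanishes and the slack is `≥ 0`).
Compared with `Negative.stub_hullRegimeAbove_false_of_deepLopsidedDatum_explicit` (p446576) the non-slot-constancy conjunct
is gone. An implication; its antecedent — an explicit arithmetic existence statement about ONE point of the `λ`-line and
ONE genuine datum there — is NOT asserted, and nothing is claimed about its certifiability. No side taken.
[cite: Mochizuki2012, IUTchIV Thm. 1.10 Step (v) p. 27–29] [claim: Mochizuki2012, status: disputed] -/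
theorem not_stub_hullRegimeAbove_of_lopsidedDatum
    (H : ∃ (P : NFPoint) (_ : P ∈ UP) (l : ℕ) (_ : l.Prime) (_ : 5 ≤ l) (_ : Cor22.AdmitsCore P)
        (_ : Cor22.CondP2 P l) (_ : Cor22.CondP5 P l) (_ : Cor22.CondP6 P l) (_ : 2 ≤ Cor22.dmod P)
        (_ : 40 * Real.log (((2 ^ 12 * 3 ^ 3 * 5 * Cor22.dmod P : ℕ) : ℝ) * l)
          * ((Nat.primeCounting (2 ^ 12 * 3 ^ 3 * 5 * Cor22.dmod P * l) : ℝ)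
            - (2 * (Cor22.dmod P : ℝ) * (P.logDiff + Cor22.logCondAvoid P {2, l}) + Real.log (2 * 3 * 5 * (l : ℝ)))
              / Real.log 2) < Cor22.logQAvoid P {2, l})
        (_ : 4 * Cor22.dmod P ≤ l + 5)
        (T : Cor22.ThetaVolumeDatumAt P l),
        (letI := T.instFieldF; letI := T.instNumberFieldF; letI := T.instAlgebraF; letI := T.instFieldK
         letI := T.instNumberFieldK; letI := T.instAlgebraK; letI := T.instFieldFbar; letI := T.instAlgebraFbar
         letI := T.instAlgebraKFbar; letI := T.instIsElliptic
         ∃ (p : ℕ) (hp : p.Prime) (_ : p ∈ T.I.supportPrimes),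
           haveI : Fact p.Prime := ⟨hp⟩
           ∃ v w : placesOver (fieldOfModuli T.E) p,
             ((l : ℝ) + 1) / 4 *
                 ((1 + 12 * (Cor22.dmod P : ℝ) / l) * (P.logDiff + Cor22.logCondAvoid P {2, l})
                   + 2 * Real.log l + 52
                   + 20 / 3 * Real.log (((2 ^ 12 * 3 ^ 3 * 5 * Cor22.dmod P : ℕ) : ℝ) * (l : ℝ))
                     * (Nat.primeCounting (2 ^ 12 * 3 ^ 3 * 5 * Cor22.dmod P * l) : ℝ))
               - (((l : ℝ) + 5) / 4 - (Cor22.dmod P : ℝ)) *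
                   (P.logDiff + (1 - 1 / (l : ℝ)) * Cor22.logCondAvoid P {2, l}) <
             weight (fieldOfModuli T.E) v.1 * weight (fieldOfModuli T.E) w.1 * ((l : ℝ) * ((l : ℝ) + 1) / 12) *
               (T.I.X.qPilot v.1 * logNorm (fieldOfModuli T.E) v.1 / (localDegree (fieldOfModuli T.E) v.1 : ℝ)
                 - T.I.X.qPilot w.1 * logNorm (fieldOfModuli T.E) w.1 /
                   (localDegree (fieldOfModuli T.E) w.1 : ℝ)))) :
    ¬ (∀ P : NFPoint, P ∈ UP → ∀ l : ℕ, l.Prime → 5 ≤ l →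
        Cor22.AdmitsCore P → Cor22.CondP2 P l → Cor22.CondP5 P l → Cor22.CondP6 P l →
        2 ≤ Cor22.dmod P →
        40 * Real.log (((2 ^ 12 * 3 ^ 3 * 5 * Cor22.dmod P : ℕ) : ℝ) * l)
          * ((Nat.primeCounting (2 ^ 12 * 3 ^ 3 * 5 * Cor22.dmod P * l) : ℝ)
            - (2 * (Cor22.dmod P : ℝ) * (P.logDiff + Cor22.logCondAvoid P {2, l}) + Real.log (2 * 3 * 5 * (l : ℝ)))
              / Real.log 2) < Cor22.logQAvoid P {2, l} →
        ∀ T : Cor22.ThetaVolumeDatumAt P l,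
          (letI := T.instFieldF; letI := T.instNumberFieldF; letI := T.instAlgebraF; letI := T.instFieldK
           letI := T.instNumberFieldK; letI := T.instAlgebraK; letI := T.instFieldFbar; letI := T.instAlgebraFbar
           letI := T.instAlgebraKFbar; letI := T.instIsElliptic
           ¬ (∀ p ∈ T.I.supportPrimes, ∀ v w : placesOver (fieldOfModuli T.E) p,
              (DHData.ofInput T.I).logQloc p v = (DHData.ofInput T.I).logQloc p w)) →
          T.HullEstimateOf
            (((l : ℝ) + 1) / 4 *
              ((1 + 12 * (Cor22.dmod P : ℝ) / l) * (P.logDiff + Cor22.logCondAvoid P {2, l})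
                + 2 * Real.log l + 52
                + 20 / 3 * Real.log (((2 ^ 12 * 3 ^ 3 * 5 * Cor22.dmod P : ℕ) : ℝ) * (l : ℝ))
                  * (Nat.primeCounting (2 ^ 12 * 3 ^ 3 * 5 * Cor22.dmod P * l) : ℝ)))) := by
  intro habove
  obtain ⟨P, hP, l, hl, h5, hcore, h2, h5', h6, hd2, hthr, hdl, T, hrest⟩ := H
  letI := T.instFieldF; letI := T.instNumberFieldF; letI := T.instAlgebraF; letI := T.instFieldK
  letI := T.instNumberFieldK; letI := T.instAlgebraK; letI := T.instFieldFbar; letI := T.instAlgebraFbar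
  letI := T.instAlgebraKFbar; letI := T.instIsElliptic
  obtain ⟨p, hp, hpT, v, w, hlt⟩ := hrest
  haveI : Fact p.Prime := ⟨hp⟩
  have hle := pair_le_slack_of_stub_hullRegimeAbove habove P hP l hl h5 hcore h2 h5' h6 hd2 hthr hdl T p hpT v w
  exact absurd hle (not_le.mpr hlt)

end Summit.ABC.ABC.Theorems.ThetaPartII

end
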